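import Mathlib.NumberTheory.Height.NumberField
import Mathlib.NumberTheory.NumberField.InfinitePlace.Embeddings
import Mathlib.NumberTheory.Cyclotomic.PrimitiveRoots
import Mathlib.RingTheory.Polynomial.Cyclotomic.Roots
import Mathlib.Analysis.SpecialFunctions.Pow.Real
import Mathlib.Analysis.Complex.Basic
import Mathlib.RingTheory.MvPolynomial.Basic

/-!
# The spanning hypothesis of the lever `OrbitClusterBound` is load-bearing
(crux `ApproximationProperty`, stmt-Schanuel-6117; negative lemma, route DiophantineDichotomy, line
`orbit-interpolation-determinant`, stub `stub_orbitClusterBound`)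

The lever (skeleton `Cruxes/ApproximationProperty/Lines/orbit-interpolation-determinant.lean`, lead's reshape
of 2026-08-16) bounds conjugate clustering of a point `β ∈ Kᵗ` by `δ · h_K(1:β) + …` under the hypothesis
that the monomials of degree `≤ δ` in `β` SPAN `K` over `ℚ` (so `K = ℚ(β)`). Dropping that hypothesis
(everything else verbatim) gives a FALSE statement, already at `t = 1`:
`orbitClusterBound_false_without_spanning` — take `K = ℚ(ζ_p)` with `p − 1 ≥ 2/c₀`, `β = 0`, `δ = 0`, ALL
`k = p − 1` embeddings (they send `β` to the same point `0 = x`), `r = e^{−M}`: the left side is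
`k (c₀ k − 1) M ≥ M`, the right side `C (k log(k+1) + k log 2)` does not see `M`. So any proof of the lever
must use that `β` generates `K` in degree `≤ δ` (it is what makes distinct embeddings give distinct points).

Everything is proved; no definitions, no named facts. Companion of `…/Negative/OrbitClusterBoundShape.lean`
(`c₀ ≤ 1`, injectivity).
-/

noncomputable section

-- `Summit.Schanuel.Schanuel.…` is the mandated summit/sub-problem namespace (single-conjunct summit):
set_option linter.dupNamespace false

namespace Summit.Schanuel.Schanuel.Theorems.ApproximationPropertyOrbitClusterBoundSpanning

open Polynomial

/-- **The spanning hypothesis of `OrbitClusterBound` is load-bearing.** The lever with the hypothesis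
"monomials of degree `≤ δ` in `β` span `K`" dropped (everything else verbatim) is FALSE at `t = 1`:
witness `K = ℚ(ζ_p)`, `p` prime with `p − 1 ≥ 2/c₀`, `β = 0`, `δ = 0`, all `p − 1` complex embeddings,
`x = 0`, `r = e^{−M}` with `M = C (k log(k+1) + k log 2) + 1`, `k = p − 1`. [folklore] -/
theorem orbitClusterBound_false_without_spanning :
    ¬ (∀ t : ℕ, 1 ≤ t → ∃ c₀ : ℝ, 0 < c₀ ∧ ∃ C : ℝ, 0 < C ∧
      ∀ (K : Type) [Field K] [NumberField K] (β : Fin t → K) (δ k : ℕ) (σ : Fin k → (K →+* ℂ))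
        (x : Fin t → ℂ) (r : ℝ),
        Function.Injective σ → 0 < r → r ≤ 1 →
        (∀ i, ‖(fun j => σ i (β j)) - x‖ ≤ r) →
        (c₀ * (k : ℝ) ^ (1 + 1 / (t : ℝ)) - k) * Real.log (1 / r) ≤
          C * (δ * Height.logHeight (Fin.cons (1 : K) β : Fin (t + 1) → K) +
            Module.finrank ℚ K * Real.log (Module.finrank ℚ K + 1) +
            k * δ * Real.log (2 + ‖x‖) + k * Real.log ((δ : ℝ) + 2))) := by
  intro h
  obtain ⟨c₀, hc₀, C, hC, hall⟩ := h 1 le_rfl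
  -- a prime `p` with `p - 1 ≥ ⌈2/c₀⌉₊`
  obtain ⟨p, hpN, hp⟩ := Nat.exists_infinite_primes (⌈2 / c₀⌉₊ + 1)
  haveI : NeZero p := ⟨hp.ne_zero⟩
  haveI : Fact p.Prime := ⟨hp⟩
  -- a number field of degree `p - 1` (`K = ℚ(ζ_p)`) and ALL its complex embeddings
  obtain ⟨K, _instF, _instNF, hKdeg⟩ :
      ∃ (K : Type) (_ : Field K) (_ : NumberField K), Module.finrank ℚ K = p - 1 := by
    refine ⟨CyclotomicField p ℚ, inferInstance, inferInstance, ?_⟩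
    haveI : IsCyclotomicExtension {p} ℚ (CyclotomicField p ℚ) :=
      CyclotomicField.isCyclotomicExtension p ℚ
    rw [IsCyclotomicExtension.finrank (n := p) (K := ℚ) (CyclotomicField p ℚ)
      (cyclotomic.irreducible_rat hp.pos), Nat.totient_prime hp]
  set k : ℕ := Fintype.card (K →+* ℂ) with hk
  have hfin : Module.finrank ℚ K = k := (NumberField.Embeddings.card K ℂ).symm
  have hkp : k = p - 1 := by rw [← hfin, hKdeg]
  have hkN : ⌈2 / c₀⌉₊ ≤ k := by rw [hkp]; omega
  have hk2 : 2 / c₀ ≤ (k : ℝ) := (Nat.le_ceil _).trans (by exact_mod_cast hkN)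
  have hkc : 2 ≤ c₀ * k := by
    have := mul_le_mul_of_nonneg_left hk2 hc₀.le
    rwa [mul_div_cancel₀ _ hc₀.ne'] at this
  have hk0 : (0 : ℝ) ≤ k := Nat.cast_nonneg _
  have hk1 : (1 : ℝ) ≤ k := by
    by_contra hlt
    have hlt' : (k : ℝ) < 1 := not_le.mp hlt
    have hk00 : k = 0 := by
      have : k < 1 := by exact_mod_cast hlt'
      omega
    have : (k : ℝ) = 0 := by exact_mod_cast hk00
    rw [this, mul_zero] at hkc
    linarith
  let σ : Fin k → (K →+* ℂ) := fun i => (Fintype.equivFin (K →+* ℂ)).symm i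
  have hσ : Function.Injective σ := (Fintype.equivFin (K →+* ℂ)).symm.injective
  -- the scale
  set M : ℝ := C * ((k : ℝ) * Real.log (k + 1) + k * Real.log 2) + 1 with hM
  have hlog2 : 0 ≤ Real.log 2 := Real.log_nonneg (by norm_num)
  have hlogk : 0 ≤ Real.log ((k : ℝ) + 1) := Real.log_nonneg (by linarith)
  have hM0 : 0 ≤ M := by
    have : 0 ≤ C * ((k : ℝ) * Real.log (k + 1) + k * Real.log 2) := by positivity
    linarith
  have hr0 : 0 < Real.exp (-M) := Real.exp_pos _
  have hr1 : Real.exp (-M) ≤ 1 := by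
    rw [Real.exp_le_one_iff]; linarith
  have hclu : ∀ i : Fin k, ‖(fun j : Fin 1 => σ i ((0 : Fin 1 → K) j)) - 0‖ ≤ Real.exp (-M) := by
    intro i
    have h0 : (fun j : Fin 1 => σ i ((0 : Fin 1 → K) j)) - 0 = 0 := by ext j; simp
    rw [h0, norm_zero]
    exact hr0.le
  have key := hall K (0 : Fin 1 → K) 0 k σ 0 (Real.exp (-M)) hσ hr0 hr1 hclu
  rw [show Real.log (1 / Real.exp (-M)) = M by
        rw [Real.exp_neg, one_div, inv_inv, Real.log_exp], hfin] at key
  have hpow : ((k : ℕ) : ℝ) ^ (1 + 1 / ((1 : ℕ) : ℝ)) = (k : ℝ) * k := by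
    rw [Nat.cast_one, div_one, show (1 : ℝ) + 1 = (2 : ℕ) by norm_num, Real.rpow_natCast, pow_two]
  rw [hpow] at key
  simp only [Nat.cast_zero, zero_mul, zero_add, mul_zero, add_zero] at key
  -- key : (c₀ * (k * k) - k) * M ≤ C * (k * Real.log (k + 1) + k * Real.log 2)
  have hcoef : (1 : ℝ) ≤ c₀ * (k * k) - k := by
    have e : c₀ * (k * k) - k = k * (c₀ * k - 1) := by ring
    rw [e]; nlinarith
  have hLHS : M ≤ (c₀ * (k * k) - k) * M := by nlinarith
  linarith

end Summit.Schanuel.Schanuel.Theorems.ApproximationPropertyOrbitClusterBoundSpanning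

end
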